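import Literature.Analysis.FluidPDE.LocalLerayPressureBoundHolds
import Literature.Analysis.FluidPDE.JiaSverak2014SlabAprioriEstimate
import HarnessLib

/-!
# Unit-scale smallness of a local energy solution on a short initial slab
(inputs of the initial-time Caffarelli–Kohn–Nirenberg induction; towards Barker–Prange 2020, Thm. 1)

Analysis/FluidPDE proofs file (theorems only, no definitions, no named facts) on the discharge
path of the named fact `Literature.Analysis.FluidPDE.BarkerPrange2020_thm2`
(`BarkerPrangeConcentration.lean`; T. Barker, C. Prange, Arch. Ration. Mech. Anal. 236 (2020) =
arXiv:1812.09115, Thm. 2). The initial-time induction (`InitialTimeCKNInduction.lean`) starts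
from the one-scale smallness `∫∫_{Q_1(z₀)} (|u|³ + |p|^{3/2}) ≤ ε₀` of the zero extension of a local
energy solution, i.e. from `∫₀^S ∫_{B_1(x₀)} (|v|³ + |π - c(t)|^{3/2}) ≤ ε₀` for a suitable time
gauge `c`. For a local energy solution whose datum is bounded by `M` in `L²_uloc` this holds as
soon as `S ≤ S(M)` is small (Barker–Prange 2020, §4.1: the a priori bound of Jia–Šverák /
Kikuchi–Seregin / Lemarié-Rieusset up to `S_lews = c min(M⁻⁴, 1)`, the energy-subcritical decay
`∫₀^S∫ |u|³ ≲ S^{1/10}` of (15.16)-type terms, and the pressure estimate (pressureapriori)):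

* `BarkerPrange2020.pressure_osc_cube_box_le_rpow_time` — **the local `L³ × L^{3/2}` bound with
  an explicit power of the time**: for `R > 0` and a uniformly local energy level `A` there is
  `K = K(R, A)` such that every local Leray solution `(v, π)` on `(0, T) × ℝ³`, `T ≤ 1`, with
  unit-ball energies and unit-box dissipations `≤ A` satisfies, at every centre `x₀`,
  `∫₀ᵀ∫_{B_R(x₀)} (|v|³ + |π - ⨍_{B_R(x₀)} π|^{3/2}) ≤ K T^{1/4}` (the proof of the accepted
  `kangMiuraTsai_local_pressure_bound_holds` — Kang–Miura–Tsai 2021, Lemma 3.4 / §8, via the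
  tree's Liouville–oscillation route — with the dependence on `T` of its constant kept explicit:
  the cubic term is `≲ T^{1/4}` by the interpolation inequality and the far-field tail `≲ T`);
* `BarkerPrange2020.exists_unitScale_small` — **unit-scale smallness on a short slab**: for every
  `α` and `ε > 0` there is `S₀ = S₀(α, ε) > 0` such that every local energy solution `(v, π)` on
  `ℝ³ × (0, S)`, `S ≤ S₀`, with datum `∫_{B_1(x₀)} |v₀|² ≤ 2α`, admits a time gauge
  `c ∈ L^{3/2}(0, S)` with `∫₀^S∫_{B_1(x₀)} (|v|³ + |π - c|^{3/2}) ≤ ε` at every `x₀`, together with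
  the uniform bounds on the unit-ball energies (every `t ∈ [0, S]`) and on the unit-box
  dissipation of the weak gradient of the class (the a priori estimate
  `JiaSverak2014.apriori_unit_scale_slab` — Jia–Šverák 2013, Lemma 2 — then the first result).

## References

* T. Barker, C. Prange, Arch. Ration. Mech. Anal. 236 (2020) = arXiv:1812.09115, §4.1.
  [BarkerPrange2020]
* K. Kang, H. Miura, T.-P. Tsai, IMRN 2021 = arXiv:1812.10509, Lemmas 3.4–3.5, §8.
  [KangMiuraTsai2020]
* H. Jia, V. Šverák, SIAM J. Math. Anal. 45 (2013) = arXiv:1201.1592, Lemma 2. [JiaSverak2013]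
-/

noncomputable section

open MeasureTheory Set Filter Topology Function Metric
open scoped ENNReal NNReal RealInnerProductSpace Laplacian

namespace Literature.Analysis.FluidPDE

namespace BarkerPrange2020

-- nested operator types `ℝ³ →L[ℝ] ℝ³ →L[ℝ] ℝ³ →L[ℝ] ℝ`
set_option maxSynthPendingDepth 3

set_option maxHeartbeats 1600000 in
/-- **The local `L³ × L^{3/2}` bound of a local Leray solution with an explicit power of the time.**
For `R > 0` and `A ≥ 0` there is `K = K(R, A)` such that: for every `0 < T ≤ 1`, every local Leray
solution `(v, π)` on `(0, T) × ℝ³` (unit viscosity) with `∫_{B_1(x₀)} |v(t)|² ≤ A` for a.e.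
`t ∈ (0,T)` and all `x₀`, and with a weak spatial gradient `G` on the slab satisfying
`∫₀ᵀ∫_{B_1(x₀)} |G|² ≤ A` for all `x₀`, and for every centre `x₀`,
`∫₀ᵀ∫_{B_R(x₀)} (|v|³ + |π - ⨍_{B_R(x₀)} π(t)|^{3/2}) ≤ K T^{1/4}` (the mean gauge
`t ↦ ⨍_{B_R(x₀)} π(t)` is in `L^{3/2}(0,T)`, `IsLocalLeraySolutionOn.memLp_setAverage_pressure`).
The proof is that of the accepted `kangMiuraTsai_local_pressure_bound_holds` (Kang–Miura–Tsai
2021, §8) with the time dependence of its constant kept: the cubic functional is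
`≤ K_c A_ρ^{1/2} (A_ρ T)^{1/4} (A_ρ T + A_ρ)^{3/4} ≤ K_c A_ρ^{3/4} (2A_ρ)^{3/4} T^{1/4}` and the
far-field tail contributes `≲ T ≤ T^{1/4}`. [cite: KangMiuraTsai2020, Lemma 3.4 and its proof §8 (arXiv:1812.10509 pp. 8, 17); BarkerPrange2020 §4.1 (pressureapriori)] -/
theorem pressure_osc_cube_box_le_rpow_time (R : ℝ) (A : ℝ≥0) (hR : 0 < R) :
    ∃ K : ℝ≥0, ∀ (T : ℝ), 0 < T → T ≤ 1 →
      ∀ (v₀ : EuclideanSpace ℝ (Fin 3) → EuclideanSpace ℝ (Fin 3))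
        (v : ℝ → EuclideanSpace ℝ (Fin 3) → EuclideanSpace ℝ (Fin 3))
        (π : ℝ → EuclideanSpace ℝ (Fin 3) → ℝ),
        IsLocalLeraySolutionOn T 1 v₀ v π →
        (∀ᵐ t ∂(volume.restrict (Ioo 0 T)), ∀ x₀ : EuclideanSpace ℝ (Fin 3),
          ∫⁻ x in ball x₀ 1, ‖v t x‖ₑ ^ 2 ≤ A) →
        (∃ G : ℝ → EuclideanSpace ℝ (Fin 3) →
            EuclideanSpace ℝ (Fin 3) →L[ℝ] EuclideanSpace ℝ (Fin 3),
          HasWeakSpatialGradientOn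
              (slab (EuclideanSpace ℝ (Fin 3)) (Ioo 0 T) isOpen_Ioo) v G ∧
            ∀ x₀ : EuclideanSpace ℝ (Fin 3), ∫⁻ z in Ioo 0 T ×ˢ ball x₀ 1,
              ENNReal.ofReal (frobeniusNormSq (G z.1 z.2)) ≤ A) →
        ∀ x₀ : EuclideanSpace ℝ (Fin 3),
          ∫⁻ z in Ioo 0 T ×ˢ ball x₀ R,
              (‖v z.1 z.2‖ₑ ^ (3 : ℕ) + ‖π z.1 z.2 - ⨍ y in ball x₀ R, π z.1 y‖ₑ ^ (3 / 2 : ℝ)) ≤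
            K * ENNReal.ofReal T ^ (1 / 4 : ℝ) := by
  -- ## constants
  obtain ⟨CN, CK, hCK0, hslice⟩ := slice_pressure_oscillation_le
  obtain ⟨Kc, hKc⟩ := exists_lintegral_cube_box_le_explicit (2 * (R + 1))
  set V1 : ℝ≥0∞ := volume (ball (0 : EuclideanSpace ℝ (Fin 3)) 1) with hV1
  set Vρ : ℝ≥0∞ := volume (ball (0 : EuclideanSpace ℝ (Fin 3)) (2 * (R + 1) + 1)) with hVρ
  set Aρ : ℝ≥0∞ := V1⁻¹ * ((A : ℝ≥0∞) * Vρ) with hAρ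
  set CUBEc : ℝ≥0∞ := Kc * Aρ ^ (1 / 2 : ℝ) * (Aρ ^ (1 / 4 : ℝ) * (Aρ + Aρ) ^ (3 / 4 : ℝ)) with hCUBEc
  set TailB : ℝ≥0∞ := V1⁻¹ * ((A : ℝ≥0∞) *
    (16 * ∫⁻ z in (ball (0 : EuclideanSpace ℝ (Fin 3)) (2 * (R + 1) - 1))ᶜ, RieszKernel.powKer 4 z))
    with hTailB
  set VR : ℝ≥0∞ := volume (ball (0 : EuclideanSpace ℝ (Fin 3)) R) with hVR
  set s2 : ℝ≥0∞ := (2 : ℝ≥0∞) ^ (1 / 2 : ℝ) with hs2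
  set Kp : ℝ≥0∞ := 4 * (s2 * ((CN : ℝ≥0∞) ^ (3 / 2 : ℝ) * CUBEc +
    VR * (ENNReal.ofReal (CK * (R + 1)) * TailB) ^ (3 / 2 : ℝ))) with hKp
  set Ktot : ℝ≥0∞ := CUBEc + Kp with hKtot
  -- ## finiteness of the constants
  have hV10 : V1 ≠ 0 := (measure_ball_pos volume _ one_pos).ne'
  have hV1inv : V1⁻¹ ≠ ⊤ := ENNReal.inv_ne_top.2 hV10
  have hVρtop : Vρ ≠ ⊤ := measure_ball_lt_top.ne
  have hAρtop : Aρ ≠ ⊤ :=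
    ENNReal.mul_ne_top hV1inv (ENNReal.mul_ne_top ENNReal.coe_ne_top hVρtop)
  have hCUBEctop : CUBEc ≠ ⊤ := by
    refine ENNReal.mul_ne_top (ENNReal.mul_ne_top ENNReal.coe_ne_top
      (ENNReal.rpow_ne_top_of_nonneg (by norm_num) hAρtop)) (ENNReal.mul_ne_top ?_ ?_)
    · exact ENNReal.rpow_ne_top_of_nonneg (by norm_num) hAρtop
    · exact ENNReal.rpow_ne_top_of_nonneg (by norm_num) (ENNReal.add_ne_top.2 ⟨hAρtop, hAρtop⟩)
  have hTailBtop : TailB ≠ ⊤ := by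
    refine ENNReal.mul_ne_top hV1inv (ENNReal.mul_ne_top ENNReal.coe_ne_top
      (ENNReal.mul_ne_top (by norm_num) ?_))
    exact (RieszKernel.lintegral_compl_ball_powKer_lt_top (by norm_num) (by linarith)).ne
  have hs2top : s2 ≠ ⊤ := ENNReal.rpow_ne_top_of_nonneg (by norm_num) ENNReal.ofNat_ne_top
  have hVRtop : VR ≠ ⊤ := measure_ball_lt_top.ne
  have hKp_top : Kp ≠ ⊤ := by
    refine ENNReal.mul_ne_top (by norm_num) (ENNReal.mul_ne_top hs2top (ENNReal.add_ne_top.2 ⟨?_, ?_⟩))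
    · exact ENNReal.mul_ne_top (ENNReal.rpow_ne_top_of_nonneg (by norm_num) ENNReal.coe_ne_top) hCUBEctop
    · exact ENNReal.mul_ne_top hVRtop (ENNReal.rpow_ne_top_of_nonneg (by norm_num)
        (ENNReal.mul_ne_top ENNReal.ofReal_ne_top hTailBtop))
  have hKtot_top : Ktot ≠ ⊤ := ENNReal.add_ne_top.2 ⟨hCUBEctop, hKp_top⟩
  -- ## the bound `K = Ktot`
  refine ⟨Ktot.toNNReal, fun T hT hT1 v₀ v π hv hE hGex x₀ => ?_⟩
  rw [ENNReal.coe_toNNReal hKtot_top]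
  obtain ⟨G, hG, hGb⟩ := hGex
  set IT : ℝ≥0∞ := volume (Ioo (0 : ℝ) T) with hIT
  have hITeq : IT = ENNReal.ofReal T := by rw [hIT, Real.volume_Ioo, sub_zero]
  have hIT1 : IT ≤ 1 := by rw [hITeq, ← ENNReal.ofReal_one]; exact ENNReal.ofReal_le_ofReal hT1
  have hITtop : IT ≠ ⊤ := by rw [hITeq]; exact ENNReal.ofReal_ne_top
  set CUBE : ℝ≥0∞ := Kc * Aρ ^ (1 / 2 : ℝ) *
    ((Aρ * IT) ^ (1 / 4 : ℝ) * (Aρ * IT + Aρ) ^ (3 / 4 : ℝ)) with hCUBE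
  have hCUBEle : CUBE ≤ CUBEc * IT ^ (1 / 4 : ℝ) := by
    have h1 : (Aρ * IT) ^ (1 / 4 : ℝ) = Aρ ^ (1 / 4 : ℝ) * IT ^ (1 / 4 : ℝ) :=
      ENNReal.mul_rpow_of_nonneg _ _ (by norm_num)
    have h2 : (Aρ * IT + Aρ) ^ (3 / 4 : ℝ) ≤ (Aρ + Aρ) ^ (3 / 4 : ℝ) := by
      gcongr
      calc Aρ * IT ≤ Aρ * 1 := by gcongr
        _ = Aρ := mul_one _
    calc CUBE = Kc * Aρ ^ (1 / 2 : ℝ) * (Aρ ^ (1 / 4 : ℝ) * IT ^ (1 / 4 : ℝ) * (Aρ * IT + Aρ) ^ (3 / 4 : ℝ)) := by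
          rw [hCUBE, h1]
      _ ≤ Kc * Aρ ^ (1 / 2 : ℝ) * (Aρ ^ (1 / 4 : ℝ) * IT ^ (1 / 4 : ℝ) * (Aρ + Aρ) ^ (3 / 4 : ℝ)) := by
          gcongr
      _ = CUBEc * IT ^ (1 / 4 : ℝ) := by rw [hCUBEc]; ring
  have hITle : IT ≤ IT ^ (1 / 4 : ℝ) := by
    conv_lhs => rw [← ENNReal.rpow_one IT]
    exact ENNReal.rpow_le_rpow_of_exponent_ge hIT1 (by norm_num)
  -- ## names
  set B : Set (EuclideanSpace ℝ (Fin 3)) := ball x₀ R with hB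
  set μt : Measure ℝ := volume.restrict (Ioo (0 : ℝ) T) with hμt
  set μB : Measure (EuclideanSpace ℝ (Fin 3)) := volume.restrict B with hμB
  set g₃ : ℝ → ℝ≥0∞ := fun t => ∫⁻ x in ball x₀ (2 * (R + 1)), ‖v t x‖ₑ ^ (3 : ℕ) with hg₃
  set c : ℝ → ℝ := fun t => ⨍ y in B, π t y with hc
  -- ## measurability
  have hvm := hv.aestronglyMeasurable_prod
  have hπm := hv.aestronglyMeasurable_pressure
  have hbox : ∀ S : Set (EuclideanSpace ℝ (Fin 3)),
      μt.prod (volume.restrict S) = volume.restrict (Ioo (0 : ℝ) T ×ˢ S) := fun S => by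
    rw [hμt, Measure.prod_restrict, ← Measure.volume_eq_prod]
  have hvmS : ∀ S : Set (EuclideanSpace ℝ (Fin 3)),
      AEStronglyMeasurable (uncurry v) (μt.prod (volume.restrict S)) := fun S =>
    hvm.mono_measure (Measure.prod_mono le_rfl Measure.restrict_le_self)
  have hF : ∀ (S : Set (EuclideanSpace ℝ (Fin 3))) (n : ℕ),
      AEMeasurable (fun z : ℝ × EuclideanSpace ℝ (Fin 3) => ‖v z.1 z.2‖ₑ ^ n)
        (μt.prod (volume.restrict S)) := fun S n => (hvmS S).enorm.pow_const n
  have hGm : AEStronglyMeasurable (uncurry G) (volume.restrict (Ioo (0 : ℝ) T ×ˢ univ)) := by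
    rw [← coe_slab_Ioo]
    exact hG.locallyIntegrableOn_grad.aestronglyMeasurable
  have hFG : ∀ S : Set (EuclideanSpace ℝ (Fin 3)), AEMeasurable
      (fun z : ℝ × EuclideanSpace ℝ (Fin 3) => ENNReal.ofReal (frobeniusNormSq (G z.1 z.2)))
      (μt.prod (volume.restrict S)) := fun S => by
    have h1 : AEStronglyMeasurable (uncurry G) (μt.prod (volume.restrict S)) := by
      rw [hbox]
      exact hGm.mono_measure (Measure.restrict_mono (prod_mono Subset.rfl (subset_univ _)) le_rfl)
    exact (continuous_frobeniusNormSq'.comp_aestronglyMeasurable h1).aemeasurable.ennreal_ofReal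
  have hslice_meas := hv.ae_aestronglyMeasurable_slice'
  -- ## the uniformly local energy on balls of radius `2(R+1)`, a.e. in time
  have hAρ_t : ∀ᵐ t ∂μt, ∫⁻ x in ball x₀ (2 * (R + 1)), ‖v t x‖ₑ ^ 2 ≤ Aρ := by
    filter_upwards [hslice_meas, hE] with t hmt hEt
    exact setLIntegral_ball_le_of_forall_unitBall (hmt.enorm.pow_const 2) hEt x₀ (2 * (R + 1))
  -- ## the uniformly local gradient bound on the box of radius `2(R+1)`
  have hGρ : ∫⁻ z in Ioo 0 T ×ˢ ball x₀ (2 * (R + 1)),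
      ENNReal.ofReal (frobeniusNormSq (G z.1 z.2)) ≤ Aρ := by
    set gG : EuclideanSpace ℝ (Fin 3) → ℝ≥0∞ := fun y =>
      ∫⁻ t in Ioo 0 T, ENNReal.ofReal (frobeniusNormSq (G t y)) with hgG
    have hton : ∀ S : Set (EuclideanSpace ℝ (Fin 3)), ∫⁻ z in Ioo 0 T ×ˢ S,
        ENNReal.ofReal (frobeniusNormSq (G z.1 z.2)) = ∫⁻ y in S, gG y := fun S => by
      rw [← hbox S, lintegral_prod_symm _ (hFG S)]
    have hgGm : AEMeasurable gG volume := by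
      have h1 : AEMeasurable
          (fun z : ℝ × EuclideanSpace ℝ (Fin 3) => ENNReal.ofReal (frobeniusNormSq (G z.1 z.2)))
          (μt.prod (volume : Measure (EuclideanSpace ℝ (Fin 3)))) := by
        have := hFG univ
        rwa [Measure.restrict_univ] at this
      exact h1.prod_swap.lintegral_prod_right'
    have hunit : ∀ z : EuclideanSpace ℝ (Fin 3), ∫⁻ y in ball z 1, gG y ≤ (A : ℝ≥0∞) := fun z => by
      rw [← hton]
      exact hGb z
    rw [hton]
    exact setLIntegral_ball_le_of_forall_unitBall hgGm hunit x₀ (2 * (R + 1))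
  -- ## the cubic functional on the box of radius `2(R+1)`
  have hG₃le : ∫⁻ z in Ioo 0 T ×ˢ ball x₀ (2 * (R + 1)), ‖v z.1 z.2‖ₑ ^ (3 : ℕ) ≤ CUBE :=
    hKc T v G x₀ Aρ Aρ hAρtop hG hAρ_t hGρ
  have hg₃m : AEMeasurable g₃ μt := (hF (ball x₀ (2 * (R + 1))) 3).lintegral_prod_right'
  have hT3 : ∫⁻ z in Ioo 0 T ×ˢ ball x₀ (2 * (R + 1)), ‖v z.1 z.2‖ₑ ^ (3 : ℕ) = ∫⁻ t, g₃ t ∂μt := by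
    rw [← hbox, lintegral_prod _ (hF _ 3)]
  -- ## the a.e. slice identities (Liouville) and the slice oscillation estimate
  obtain ⟨A', hgood⟩ := hv.ae_slice_pgIdentity
  have hIB : ∀ᵐ t ∂μt, IntegrableOn (π t) B volume := by
    filter_upwards [hv.ae_locallyIntegrable_pressure_slice] with t ht
    exact (ht.integrableOn_isCompact (isCompact_closedBall x₀ R)).mono_set ball_subset_closedBall
  have hinner : ∀ᵐ t ∂μt, ∫⁻ x, ‖π t x - c t‖ₑ ^ (3 / 2 : ℝ) ∂μB ≤
      4 * (s2 * ((CN : ℝ≥0∞) ^ (3 / 2 : ℝ) * g₃ t +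
        VR * (ENNReal.ofReal (CK * (R + 1)) * TailB) ^ (3 / 2 : ℝ))) := by
    filter_upwards [hgood, hE, hIB, hslice_meas] with t ht hEt hIBt hmt
    obtain ⟨-, -, hπt, -, -, hid⟩ := ht
    obtain ⟨κ, hκ⟩ := hslice (v t) (A : ℝ≥0∞) (π t) hmt ENNReal.coe_ne_top hEt hπt hid x₀ R hR
    have hB0 : volume B ≠ 0 := (measure_ball_pos volume x₀ hR).ne'
    have hBt : volume B ≠ ⊤ := measure_ball_lt_top.ne
    have hmean := setLIntegral_rpow_sub_average_le_of_const hB0 hBt hIBt κ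
    -- the far-field tail at time `t` is bounded uniformly
    have hfar : ∫⁻ y in (ball x₀ (2 * (R + 1)))ᶜ,
        ‖v t y‖ₑ ^ (2 : ℕ) * RieszKernel.powKer 4 (y - x₀) ≤ TailB :=
      lintegral_compl_ball_mul_powKer_le (hmt.enorm.pow_const _) hEt x₀ (by linarith)
    calc ∫⁻ x, ‖π t x - c t‖ₑ ^ (3 / 2 : ℝ) ∂μB
        ≤ 4 * ∫⁻ x in B, ‖π t x - κ‖ₑ ^ (3 / 2 : ℝ) := hmean
      _ ≤ 4 * (s2 * ((CN : ℝ≥0∞) ^ (3 / 2 : ℝ) * g₃ t +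
          volume B * (ENNReal.ofReal (CK * (R + 1)) *
            ∫⁻ y in (ball x₀ (2 * (R + 1)))ᶜ,
              ‖v t y‖ₑ ^ (2 : ℕ) * RieszKernel.powKer 4 (y - x₀)) ^ (3 / 2 : ℝ))) :=
          mul_le_mul' le_rfl hκ
      _ ≤ 4 * (s2 * ((CN : ℝ≥0∞) ^ (3 / 2 : ℝ) * g₃ t +
          VR * (ENNReal.ofReal (CK * (R + 1)) * TailB) ^ (3 / 2 : ℝ))) := by
          rw [hB, Measure.addHaar_ball_center volume x₀ R]
          gcongr
  -- ## integrate in time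
  have hGm' : AEStronglyMeasurable
      (fun z : ℝ × EuclideanSpace ℝ (Fin 3) => π z.1 z.2 - c z.1) (μt.prod μB) := by
    refine AEStronglyMeasurable.sub ?_ ?_
    · rw [hμB, hbox]
      exact hπm.mono_measure (Measure.restrict_mono (prod_mono Subset.rfl (subset_univ _)) le_rfl)
    · exact (hv.memLp_setAverage_pressure x₀ hR).aestronglyMeasurable.comp_fst
  have hTI : ∫⁻ z in Ioo 0 T ×ˢ B, ‖π z.1 z.2 - c z.1‖ₑ ^ (3 / 2 : ℝ) =
      ∫⁻ t, ∫⁻ x, ‖π t x - c t‖ₑ ^ (3 / 2 : ℝ) ∂μB ∂μt := by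
    rw [← hbox B, ← hμB, lintegral_prod _ (hGm'.enorm.pow_const _)]
  have hμtuniv : μt univ = IT := by rw [hμt, Measure.restrict_apply_univ]
  have hm1 : AEMeasurable (fun t => 4 * (s2 * ((CN : ℝ≥0∞) ^ (3 / 2 : ℝ) * g₃ t))) μt :=
    ((hg₃m.const_mul _).const_mul _).const_mul _
  have hP : ∫⁻ z in Ioo 0 T ×ˢ B, ‖π z.1 z.2 - c z.1‖ₑ ^ (3 / 2 : ℝ) ≤ Kp * IT ^ (1 / 4 : ℝ) := by
      calc ∫⁻ z in Ioo 0 T ×ˢ B, ‖π z.1 z.2 - c z.1‖ₑ ^ (3 / 2 : ℝ)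
          = ∫⁻ t, ∫⁻ x, ‖π t x - c t‖ₑ ^ (3 / 2 : ℝ) ∂μB ∂μt := hTI
        _ ≤ ∫⁻ t, (4 * (s2 * ((CN : ℝ≥0∞) ^ (3 / 2 : ℝ) * g₃ t +
              VR * (ENNReal.ofReal (CK * (R + 1)) * TailB) ^ (3 / 2 : ℝ)))) ∂μt := lintegral_mono_ae hinner
        _ = ∫⁻ t, (4 * (s2 * ((CN : ℝ≥0∞) ^ (3 / 2 : ℝ) * g₃ t)) +
              4 * (s2 * (VR * (ENNReal.ofReal (CK * (R + 1)) * TailB) ^ (3 / 2 : ℝ)))) ∂μt := by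
            refine lintegral_congr fun t => ?_
            ring
        _ = 4 * (s2 * ((CN : ℝ≥0∞) ^ (3 / 2 : ℝ) * ∫⁻ t, g₃ t ∂μt)) +
              4 * (s2 * (VR * (ENNReal.ofReal (CK * (R + 1)) * TailB) ^ (3 / 2 : ℝ))) * μt univ := by
            rw [lintegral_add_left' hm1, lintegral_const, lintegral_const_mul'' _ ((hg₃m.const_mul _).const_mul _),
              lintegral_const_mul'' _ (hg₃m.const_mul _), lintegral_const_mul'' _ hg₃m]
        _ ≤ 4 * (s2 * ((CN : ℝ≥0∞) ^ (3 / 2 : ℝ) * CUBE)) +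
              4 * (s2 * (VR * (ENNReal.ofReal (CK * (R + 1)) * TailB) ^ (3 / 2 : ℝ))) * IT := by
            rw [← hT3, hμtuniv]
            gcongr
        _ ≤ 4 * (s2 * ((CN : ℝ≥0∞) ^ (3 / 2 : ℝ) * (CUBEc * IT ^ (1 / 4 : ℝ)))) +
              4 * (s2 * (VR * (ENNReal.ofReal (CK * (R + 1)) * TailB) ^ (3 / 2 : ℝ))) * IT ^ (1 / 4 : ℝ) := by
            gcongr
        _ = Kp * IT ^ (1 / 4 : ℝ) := by rw [hKp]; ring

  -- ## the cubic term on `B_R(x₀)` and the conclusion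
  have hCube : ∫⁻ z in Ioo 0 T ×ˢ B, ‖v z.1 z.2‖ₑ ^ (3 : ℕ) ≤ CUBEc * IT ^ (1 / 4 : ℝ) := by
    refine le_trans (lintegral_mono_set (prod_mono Subset.rfl ?_)) (hG₃le.trans hCUBEle)
    exact ball_subset_ball (by linarith)
  have hFm : AEMeasurable (fun z : ℝ × EuclideanSpace ℝ (Fin 3) => ‖v z.1 z.2‖ₑ ^ (3 : ℕ))
      (volume.restrict (Ioo (0 : ℝ) T ×ˢ B)) := by
    rw [← hbox B]; exact hF B 3
  rw [lintegral_add_left' hFm, hITeq.symm, add_mul]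
  exact add_le_add hCube hP

/-- **Unit-scale smallness of a local energy solution on a short initial slab.** For every
`α ≥ 0` and `ε > 0` there is `S₀ = S₀(α, ε) ∈ (0, 1]` such that: for every `0 < S ≤ S₀`, every
local energy solution `(u, p)` on `ℝ³ × (0, S)` (Seregin's class, unit viscosity) with a measurable
datum `u₀`, `∫_{B_1(x₀)} |u₀|² ≤ 2α` for all `x₀`, the weak spatial gradient `G` of the class (with
its uniformly local `L²` bounds at every radius) satisfies, at every centre `x₀`,
`∫₀^S ∫_{B_1(x₀)} (|u|³ + |p - ⨍_{B_1(x₀)} p(t)|^{3/2}) ≤ ε`. Proof: the a priori estimate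
`JiaSverak2014.apriori_unit_scale_slab` (Jia–Šverák 2013, Lemma 2: for `S ≤ ε₀`, `S α² ≤ ε₀` the
unit-ball energies are `≤ 2Cα` a.e. and the unit-box dissipations `≤ Cα`), then
`pressure_osc_cube_box_le_rpow_time` with `A = 2Cα` and `K S^{1/4} ≤ ε`. [cite: JiaSverak2013, Lemma 2; KangMiuraTsai2020, Lemmas 3.4–3.5; BarkerPrange2020 §4.1] -/
theorem exists_unitScale_small (α : ℝ≥0) {ε : ℝ} (hε : 0 < ε) :
    ∃ S₀ : ℝ, 0 < S₀ ∧ S₀ ≤ 1 ∧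
      ∀ (S : ℝ), 0 < S → S ≤ S₀ →
      ∀ (u₀ : EuclideanSpace ℝ (Fin 3) → EuclideanSpace ℝ (Fin 3))
        (u : ℝ → EuclideanSpace ℝ (Fin 3) → EuclideanSpace ℝ (Fin 3))
        (p : ℝ → EuclideanSpace ℝ (Fin 3) → ℝ),
        AEStronglyMeasurable u₀ volume → IsLocalEnergySolutionOn S 1 u₀ u p →
        (∀ x₀ : EuclideanSpace ℝ (Fin 3), ∫⁻ x in ball x₀ 1, ‖u₀ x‖ₑ ^ 2 ≤ 2 * (α : ℝ≥0∞)) →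
        ∃ G : ℝ → EuclideanSpace ℝ (Fin 3) → EuclideanSpace ℝ (Fin 3) →L[ℝ] EuclideanSpace ℝ (Fin 3),
          HasWeakSpatialGradientOn (slab (EuclideanSpace ℝ (Fin 3)) (Ioo 0 S) isOpen_Ioo) u G ∧
          (∀ R : ℝ, 0 < R → ∃ C : ℝ≥0, ∀ x₀ : EuclideanSpace ℝ (Fin 3),
            ∫⁻ z in Ioo 0 S ×ˢ ball x₀ R, ENNReal.ofReal (frobeniusNormSq (G z.1 z.2)) ≤ C) ∧
          ∀ x₀ : EuclideanSpace ℝ (Fin 3),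
            ∫⁻ z in Ioo 0 S ×ˢ ball x₀ 1,
                (‖u z.1 z.2‖ₑ ^ (3 : ℕ) + ‖p z.1 z.2 - ⨍ y in ball x₀ 1, p z.1 y‖ₑ ^ (3 / 2 : ℝ)) ≤
              ENNReal.ofReal ε := by
  obtain ⟨ε₀, hε₀, hε₀1, C, Hap⟩ := JiaSverak2014.apriori_unit_scale_slab
  obtain ⟨K, HK⟩ := pressure_osc_cube_box_le_rpow_time 1 (2 * (C * α)) one_pos
  set S₀ : ℝ := min (min (ε₀ : ℝ) ((ε₀ : ℝ) / ((α : ℝ) ^ 2 + 1))) (min 1 ((ε / ((K : ℝ) + 1)) ^ 4)) with hS₀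
  have hε₀r : (0 : ℝ) < ε₀ := hε₀
  have hS₀pos : 0 < S₀ := by
    refine lt_min (lt_min hε₀r (by positivity)) (lt_min one_pos (by positivity))
  refine ⟨S₀, hS₀pos, (min_le_right _ _).trans (min_le_left _ _), ?_⟩
  intro S hS hSS₀ u₀ u p hm₀ h hdat
  have hS1 : S ≤ 1 := hSS₀.trans ((min_le_right _ _).trans (min_le_left _ _))
  have hSε₀ : S ≤ (ε₀ : ℝ) := hSS₀.trans ((min_le_left _ _).trans (min_le_left _ _))
  have hSα : S * (α : ℝ) ^ 2 ≤ (ε₀ : ℝ) := by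
    have h1 : S ≤ (ε₀ : ℝ) / ((α : ℝ) ^ 2 + 1) := hSS₀.trans ((min_le_left _ _).trans (min_le_right _ _))
    rw [le_div_iff₀ (by positivity)] at h1
    nlinarith [mul_nonneg hS.le (sq_nonneg (α : ℝ))]
  have hSK : S ≤ (ε / ((K : ℝ) + 1)) ^ 4 := hSS₀.trans ((min_le_right _ _).trans (min_le_right _ _))
  have hv := h.isLocalLeraySolutionOn
  obtain ⟨G, hG, hGR⟩ := hv.uniformLocalGradient
  obtain ⟨hE, hD, -⟩ := Hap u₀ u p G α S S hm₀ hv hG hdat hS le_rfl hSε₀ hSα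
  refine ⟨G, hG, hGR, fun x₀ => ?_⟩
  -- the energy level `A = 2Cα`
  have hcast : (2 : ℝ≥0∞) * ((C * α : ℝ≥0) : ℝ≥0∞) = ((2 * (C * α) : ℝ≥0) : ℝ≥0∞) := by push_cast; ring
  have hE' : ∀ᵐ t ∂(volume.restrict (Ioo 0 S)), ∀ x₁ : EuclideanSpace ℝ (Fin 3),
      ∫⁻ x in ball x₁ 1, ‖u t x‖ₑ ^ 2 ≤ ((2 * (C * α) : ℝ≥0) : ℝ≥0∞) := by
    filter_upwards [hE] with t ht x₁
    rw [← hcast]; exact ht x₁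
  have hGex : ∃ G' : ℝ → EuclideanSpace ℝ (Fin 3) → EuclideanSpace ℝ (Fin 3) →L[ℝ] EuclideanSpace ℝ (Fin 3),
      HasWeakSpatialGradientOn (slab (EuclideanSpace ℝ (Fin 3)) (Ioo 0 S) isOpen_Ioo) u G' ∧
        ∀ x₁ : EuclideanSpace ℝ (Fin 3), ∫⁻ z in Ioo 0 S ×ˢ ball x₁ 1,
          ENNReal.ofReal (frobeniusNormSq (G' z.1 z.2)) ≤ ((2 * (C * α) : ℝ≥0) : ℝ≥0∞) := by
    refine ⟨G, hG, fun x₁ => (hD x₁).trans ?_⟩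
    exact_mod_cast (show C * α ≤ 2 * (C * α) by
      have : 0 ≤ C * α := by positivity
      linarith)
  refine (HK S hS hS1 u₀ u p hv hE' hGex x₀).trans ?_
  -- `K S^{1/4} ≤ ε`
  have hS14 : ENNReal.ofReal S ^ (1 / 4 : ℝ) = ENNReal.ofReal (S ^ (1 / 4 : ℝ)) :=
    ENNReal.ofReal_rpow_of_nonneg hS.le (by norm_num)
  rw [hS14, show (K : ℝ≥0∞) = ENNReal.ofReal (K : ℝ) by rw [ENNReal.ofReal_coe_nnreal],
    ← ENNReal.ofReal_mul (NNReal.coe_nonneg K)]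
  refine ENNReal.ofReal_le_ofReal ?_
  have hK0 : (0 : ℝ) ≤ K := NNReal.coe_nonneg K
  have hroot : S ^ (1 / 4 : ℝ) ≤ ε / ((K : ℝ) + 1) := by
    have h1 : S ^ (1 / 4 : ℝ) ≤ ((ε / ((K : ℝ) + 1)) ^ 4) ^ (1 / 4 : ℝ) :=
      Real.rpow_le_rpow hS.le hSK (by norm_num)
    rw [← Real.rpow_natCast _ 4, ← Real.rpow_mul (by positivity)] at h1
    norm_num at h1
    exact h1
  calc (K : ℝ) * S ^ (1 / 4 : ℝ) ≤ (K : ℝ) * (ε / ((K : ℝ) + 1)) := by gcongr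
    _ ≤ ε := by
        rw [mul_div_assoc', div_le_iff₀ (by positivity)]
        nlinarith

end BarkerPrange2020

end Literature.Analysis.FluidPDE

end
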